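import Mathlib
import Summits.NavierStokesRegularity.NavierStokesRegularity.Theorems.EulerZoomLiouvillePowerGaugeEulerLiouvilleBirthDefsFour
import HarnessLib

/-!
# Crux `EulerZoomLiouville.PowerGaugeEulerLiouville` (stmt-NavierStokesRegularity-19832): the binder predicates of the
# LEAD skeleton, part 5 (SPIRAL PARITY of the four regularity-free sub-extremal senses)

Continuation of `…BirthDefsFour` (same namespace `…Theorems.PowerGaugeEulerLiouville.Birth`; importing THIS module gives all
binder predicates).  ONE predicate, `IsPastSpiralTameWeak ρ u`: the member is a Perelman SPIRAL about some `(T, x₀)` with a skew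
generator `S` on a past sub-slab (`IsPastSpiral`, part 4) AND its profile `V` satisfies one of the four REGULARITY-FREE senses that
the untwisted binder `IsPastSelfSimilarSubExtremal ρ u` (`…BirthDefsTwo`, disjuncts 2–5) reduces to sub-extremality at profile level:
(2) an `L^q` tail, `2 ≤ q ≤ 3/(1+ρ)`; (3) a weak gradient that is a.e. symmetric (confined weak curl) off a ball; (4) a weakly
irrotational far field in test-function form; (5) an integrable, square-integrable weak curl — each with `ρ < ½`.  Texts = those four
disjuncts VERBATIM with `IsPastSelfSimilar ρ T T₁ x₀ u V` replaced by `IsSkew S ∧ IsPastSpiral ρ T T₁ x₀ S u V` (LEAD 19832 g17, KEY W3-SPAR,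
2026-08-29 14:50Z; binder of `stub_nonSelfSimilarRest` v119, member `Spiral.pastSpiralTameWeak_trivial`).  `S = 0` lies inside the
untwisted binder.  Credits / senses: the LEAD's `CENSUS-19832-v119.md`.

WHAT THIS IS NOT: not NS, not E — DEFINITIONS ONLY; the crux 19832 stays OPEN.
-/

noncomputable section

open MeasureTheory Set Filter Topology Metric
open scoped ENNReal NNReal ContDiff RealInnerProductSpace

-- flat `Theorems/<Route><Decl>…` files of one crux share the namespace of the crux (tree convention)
set_option linter.dupNamespace false

namespace Summit.NavierStokesRegularity.NavierStokesRegularity.Theorems.PowerGaugeEulerLiouville.Birth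

/-- Binder of `stub_nonSelfSimilarRest` (LEAD skeleton v119): the member is a SPIRAL (O(3)-twisted self-similar) member about some
`(T, x₀)` with a skew generator `S` on a past sub-slab `τ < T₁ ≤ min 0 T`, whose profile `V` is TAME-WEAK in one of the four
regularity-free senses of `IsPastSelfSimilarSubExtremal` (disjuncts 2–5, verbatim): (2) `L^q` tail off a ball, `2 ≤ q ≤ 3/(1+ρ)`;
(3) weak gradient a.e. symmetric off a ball (confined weak curl); (4) weakly irrotational far field (test-function form);
(5) integrable and square-integrable weak curl; each with `ρ < ½`.  Each sense reduces at PROFILE level to `IsSubExtremalProfile ρ V`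
(tree: `LpProfile.subExtremal_of_memLp`, `WeakConfinedVorticity.*`), whence `IsPastSpiralSubExtremal`'s member applies. -/
@[reducible] def IsPastSpiralTameWeak (ρ : ℝ) (u : ℝ → E3 → E3) : Prop :=
  (∃ (T T₁ : ℝ) (x₀ : E3) (S : E3 →L[ℝ] E3) (V : E3 → E3) (q R₀ : ℝ),
    T₁ ≤ 0 ∧ T₁ ≤ T ∧ IsSkew S ∧ IsPastSpiral ρ T T₁ x₀ S u V ∧ ρ < 1 / 2 ∧ 2 ≤ q ∧ q ≤ 3 / (1 + ρ) ∧
      MemLp V (ENNReal.ofReal q) (volume.restrict {y : E3 | R₀ ≤ ‖y‖})) ∨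
  (∃ (T T₁ : ℝ) (x₀ : E3) (S : E3 →L[ℝ] E3) (V : E3 → E3) (G : E3 → E3 →L[ℝ] E3) (R₀ : ℝ),
    T₁ ≤ 0 ∧ T₁ ≤ T ∧ IsSkew S ∧ IsPastSpiral ρ T T₁ x₀ S u V ∧ ρ < 1 / 2 ∧
      Literature.Analysis.FunctionSpaces.HasWeakFDerivOn (⊤ : TopologicalSpace.Opens E3) volume V G ∧
      ∀ᵐ y ∂(volume : Measure E3), R₀ < ‖y‖ → ∀ v w : E3, inner ℝ (G y v) w = inner ℝ (G y w) v) ∨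
  (∃ (T T₁ : ℝ) (x₀ : E3) (S : E3 →L[ℝ] E3) (V : E3 → E3) (R₀ : ℝ),
    T₁ ≤ 0 ∧ T₁ ≤ T ∧ IsSkew S ∧ IsPastSpiral ρ T T₁ x₀ S u V ∧ ρ < 1 / 2 ∧
      ∀ g : E3 → ℝ, Literature.Analysis.FunctionSpaces.IsTestFunctionOn (⊤ : TopologicalSpace.Opens E3) g →
        tsupport g ⊆ {y : E3 | R₀ < ‖y‖} → ∀ a b : E3, ∫ x, inner ℝ (V x) (fderiv ℝ g x a • b - fderiv ℝ g x b • a) = 0) ∨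
  (∃ (T T₁ : ℝ) (x₀ : E3) (S : E3 →L[ℝ] E3) (V : E3 → E3) (G : E3 → E3 →L[ℝ] E3),
    T₁ ≤ 0 ∧ T₁ ≤ T ∧ IsSkew S ∧ IsPastSpiral ρ T T₁ x₀ S u V ∧ ρ < 1 / 2 ∧
      Literature.Analysis.FunctionSpaces.HasWeakFDerivOn (⊤ : TopologicalSpace.Opens E3) volume V G ∧
      Integrable (fun y => Literature.Analysis.FluidPDE.curlCLM (G y)) volume ∧
      MemLp (fun y => Literature.Analysis.FluidPDE.curlCLM (G y)) 2 volume)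

end Summit.NavierStokesRegularity.NavierStokesRegularity.Theorems.PowerGaugeEulerLiouville.Birth

end
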